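import Summits.AtomisticToContinuum.FouriersLaw.Theorems.JunctionLocalityNonBallisticProfileAntitone
import Summits.AtomisticToContinuum.FouriersLaw.Theorems.JunctionLocalityNonBallisticStubLightConeWindowAux4
import Summits.AtomisticToContinuum.FouriersLaw.Theorems.OddSectorIrreversibilityWitnessGlueReflection
import Summits.AtomisticToContinuum.FouriersLaw.Theorems.OddResponseBound.Negative.OddPairing

/-!
# `NonBallistic` / line `contact-current-forgetting`: the contraction profile is bounded uniformly in `N`

STATUS (worker note for the lead): complete — `contactProfile_le_uniform` proved with the registered signature;
helpers `measurePreserving_siteReflection_gibbsMeasure` (any chain with even interaction) and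
`integral_sq_bondCurrent_far_eq_near` (`∫ j_{N-2}² dμ_T = ∫ j_0² dμ_T`) live in this file.

Sub-goal `contactProfile_le_uniform` of the line `contact-current-forgetting` (crux stmt-AtomisticToContinuum-9127):
for the pinned anharmonic chain (all parameters positive) and `T > 0` there is `C = C(ω₂, lam, β, T)` with

  `φ_N(s) = ‖κ_s j_0‖²_{L²(μ_T)} + ‖κ_s j_{N-2}‖²_{L²(μ_T)} ≤ C`   for every `N ≥ 2` and every `s ≥ 0`

(`contactProfile`, `Theorems/JunctionLocalityDefs.lean`). This is the first `N`-uniform fact about the line's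
central object `φ_N`.

**Proof.** `φ_N(s) ≤ φ_N(0)` (`contactProfile_le_zero`: `L²(μ_T)`-contraction of the Gibbs-invariant kernels) and
`φ_N(0) = μ_T(j_0²) + μ_T(j_{N-2}²)` (`κ_0 = id`, `pinnedChain_evolve_of_nonpos`). The near-contact moment is bounded
uniformly in `N` by the landed static Gibbs bound `pinnedChain_integral_sq_bondCurrent_zero_le` (Gaussian integration
by parts in `p_0, p_1` and the `N`-uniform eighth position moments). The far-contact moment EQUALS the near one by
the left–right symmetry of the equilibrium chain: the site reflection `R : i ↦ N-1-i` preserves Lebesgue measure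
(`measurePreserving_siteReflection_volume`) and the Hamiltonian (`hamiltonian_siteReflection`, even interaction), hence
the Gibbs measure `μ_T = volume.tilted (-H/T)` (`measurePreserving_siteReflection_gibbsMeasure`), and
`j_0 ∘ R = -j_{N-2}` (`bondCurrent_siteReflection`), so `∫ j_{N-2}² dμ_T = ∫ (j_0 ∘ R)² dμ_T = ∫ j_0² dμ_T`.
-/

noncomputable section

namespace Summit.AtomisticToContinuum.FouriersLaw.Theorems.NonBallistic

open MeasureTheory ProbabilityTheory Set Filter Topology
open scoped NNReal ENNReal
open Literature.MathematicalPhysics.KineticTheory.HeatConduction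
open Summit.AtomisticToContinuum.FouriersLaw.Theorems.JunctionLocality

/-- **The Gibbs measure is left–right symmetric.** For any oscillator chain with even interaction `V`, the site
reflection `R : (q, p) ↦ (q ∘ rev, p ∘ rev)` preserves the Gibbs measure `μ_T = volume.tilted (-H/T)` (every `N`,
every `T`): `R` preserves Lebesgue measure and `H ∘ R = H`. [folklore] -/
theorem measurePreserving_siteReflection_gibbsMeasure (P : OscillatorChain) (hV : ∀ r, P.V (-r) = P.V r)
    (N : ℕ) (T : ℝ) :
    MeasurePreserving (siteReflection N) (P.gibbsMeasure N T) (P.gibbsMeasure N T) :=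
  OddResponseBound.Negative.OddPairing.measurePreserving_tilted
    OddSectorWitness.measurePreserving_siteReflection_volume (siteReflectionEquiv N).measurableEmbedding
    (fun x => by
      show -P.hamiltonian N (siteReflection N x) / T = -P.hamiltonian N x / T
      rw [P.hamiltonian_siteReflection hV])

/-- **The two static contact-current second moments agree**: for a chain with even interaction and `N ≥ 2`,
`∫ j_{N-2}² dμ_T = ∫ j_0² dμ_T` (`j_0 ∘ R = -j_{N-2}` and `R_* μ_T = μ_T`; no integrability needed). [folklore] -/
theorem integral_sq_bondCurrent_far_eq_near (P : OscillatorChain) (hV : ∀ r, P.V (-r) = P.V r) {N : ℕ}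
    (hN : 2 ≤ N) (T : ℝ) :
    ∫ x, P.bondCurrent N ⟨N - 2, by omega⟩ x ^ 2 ∂(P.gibbsMeasure N T) =
      ∫ x, P.bondCurrent N ⟨0, by omega⟩ x ^ 2 ∂(P.gibbsMeasure N T) := by
  have hR := measurePreserving_siteReflection_gibbsMeasure P hV N T
  have hrev : Fin.rev (⟨1, by omega⟩ : Fin N) = ⟨N - 2, by omega⟩ := by
    ext
    rw [Fin.val_rev]
  have hpt : ∀ x, P.bondCurrent N ⟨0, by omega⟩ (siteReflection N x) = -P.bondCurrent N ⟨N - 2, by omega⟩ x := by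
    intro x
    rw [P.bondCurrent_siteReflection hV N ⟨0, by omega⟩ ⟨1, by omega⟩ rfl x, hrev]
  calc ∫ x, P.bondCurrent N ⟨N - 2, by omega⟩ x ^ 2 ∂(P.gibbsMeasure N T)
      = ∫ x, P.bondCurrent N ⟨0, by omega⟩ (siteReflection N x) ^ 2 ∂(P.gibbsMeasure N T) := by
        refine integral_congr_ae (ae_of_all _ fun x => ?_)
        show P.bondCurrent N ⟨N - 2, _⟩ x ^ 2 = P.bondCurrent N ⟨0, _⟩ (siteReflection N x) ^ 2
        rw [hpt x, neg_sq]
    _ = ∫ x, P.bondCurrent N ⟨0, by omega⟩ x ^ 2 ∂(P.gibbsMeasure N T) :=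
        hR.integral_comp (siteReflectionEquiv N).measurableEmbedding
          (fun y => P.bondCurrent N ⟨0, by omega⟩ y ^ 2)

/-- **Sub-goal `contactProfile_le_uniform`** (line `contact-current-forgetting`, crux stmt-AtomisticToContinuum-9127):
the contraction profile of the pinned anharmonic chain (all parameters positive) at temperature `T > 0` is bounded
uniformly in the length: `φ_N(s) ≤ C(ω₂, lam, β, T)` for all `N ≥ 2`, `s ≥ 0` — antitonicity in `s`, `κ_0 = id`, the
`N`-uniform static bound `μ_T(j_0²) ≤ C₀`, and `μ_T(j_{N-2}²) = μ_T(j_0²)` by left–right symmetry. [folklore] -/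
theorem contactProfile_le_uniform :
    ∀ ω₂ lam β γ : ℝ, 0 < ω₂ → 0 < lam → 0 < β → 0 < γ → ∀ T : ℝ, 0 < T → ∃ C : ℝ, ∀ N : ℕ, 2 ≤ N → ∀ s : ℝ, 0 ≤ s → contactProfile (pinnedChain ω₂ lam β γ) N T s ≤ C := by
  intro ω₂ lam β γ hω hl hβ hγ T hT
  obtain ⟨C₀, hC₀⟩ := pinnedChain_integral_sq_bondCurrent_zero_le ω₂ lam β γ hω hl hβ hγ T hT
  refine ⟨C₀ + C₀, fun N hN s hs => ?_⟩
  have hN1 : 1 ≤ N := by omega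
  have h0N : 0 < N := by omega
  have h2N : N - 2 < N := by omega
  refine (contactProfile_le_zero ω₂ lam β γ hω hl hβ hγ T hT N hN1 s hs).trans ?_
  -- `φ_N(0) = ∫ j_0² + j_{N-2}² dμ_T`
  have hφ0 : contactProfile (pinnedChain ω₂ lam β γ) N T 0 =
      ∫ z, ((pinnedChain ω₂ lam β γ).bondCurrent N ⟨0, h0N⟩ z ^ 2 +
        (pinnedChain ω₂ lam β γ).bondCurrent N ⟨N - 2, h2N⟩ z ^ 2) ∂((pinnedChain ω₂ lam β γ).gibbsMeasure N T) := by
    rw [contactProfile_def]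
    refine integral_congr_ae (ae_of_all _ fun z => ?_)
    show evolve (pinnedChain ω₂ lam β γ) N T (bondCurrentAt (pinnedChain ω₂ lam β γ) N 0) 0 z ^ 2 +
        evolve (pinnedChain ω₂ lam β γ) N T (bondCurrentAt (pinnedChain ω₂ lam β γ) N (N - 2)) 0 z ^ 2 = _
    rw [pinnedChain_evolve_of_nonpos hω hl.le hβ.le hγ.le N T _ le_rfl z,
      pinnedChain_evolve_of_nonpos hω hl.le hβ.le hγ.le N T _ le_rfl z,
      bondCurrentAt_eq_bondCurrent _ h0N, bondCurrentAt_eq_bondCurrent _ h2N]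
  have hi0 := LightConeBondHeat.pinnedChain_integrable_sq_bondCurrent hω hl.le hβ hγ h0N hT ⟨0, h0N⟩
  have hi2 := LightConeBondHeat.pinnedChain_integrable_sq_bondCurrent hω hl.le hβ hγ h0N hT ⟨N - 2, h2N⟩
  rw [hφ0, integral_add hi0 hi2,
    integral_sq_bondCurrent_far_eq_near (pinnedChain ω₂ lam β γ) (pinnedChain_V_neg ω₂ lam β γ) hN T]
  have hb := hC₀ N ⟨0, h0N⟩ rfl
  linarith

end Summit.AtomisticToContinuum.FouriersLaw.Theorems.NonBallistic

end
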